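import Summits.QuantumAdvantage.QuantumAdvantage.Theorems.CubicForrelationNearExactIsExactEightFlatRM
import Summits.QuantumAdvantage.QuantumAdvantage.Theorems.CubicForrelationNearExactIsExactTenCharacter

/-!
# Crux `CubicForrelation.NearExactIsExact` (stmt-QuantumAdvantage-14043) — type E on 8 bits above `13/16`: TOOLS FOR THE ENDGAME

Certificate seat `b2b-cforr-cert` (generation 2), rung `θ₈ = 13/16`.  HONEST FRAMING: elementary lemmas feeding a theorem about cubic
Boolean functions on 8 bits (the finite slice `n = 8` of the crux) — NOT summit progress.

The endgame of the type-E half (seat folder `PROOF-N8.md`, steps E5–E7: 2-flat parities on the split flat `Z = x₀ ⊕ V₀`, the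
`±`-character `A` on `Z`, the parity kill of the exceptional points through `W_f ∈ 8ℤ`, and the clean kill `wt(ι) = 16 > 8`) consumes the
following tools, landed here separately:
* `tep_sum_split`, `tep_flatPt_nil`: peeling parametrised flats one direction at a time (with the landed `erm_flatPt_cons`);
* `tep_mod_four`: `v = 4⌊v/4⌋ + 2[⌊v/2⌋ odd] + [v odd]`;
* `tep_dirs`: two transversal directions `d₁, d₂` with `d₁, d₂, d₁ ⊕ d₂ ∉ V₀` (`|V₀| ≤ 127`);
* `tep_parity_translate`: for `x ∈ Z`, `c ∈ V₀`: `x ⊕ c ⊕ t ∈ Z ⇔ t ∈ V₀`;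
* `tep_char_coset`: a `±1` function on the coset `x₀ ⊕ V₀` that is multiplicative along `V₀` has every twisted coset sum in `{0, ±|V₀|}`
  (the landed `sum_char_subspace`);
* `tep_abs_sum_le`: if a transform takes values in `{0, ±64}` with energy `2⁸·64`, its pairing with any `[−1,1]`-valued function is `≤ 256`
  in absolute value (exactly four non-zero frequencies).

References: R. O'Donnell, *Analysis of Boolean Functions*, CUP 2014, §3.3; C. Carlet, *Boolean Functions for Cryptography and Coding Theory*,
CUP 2021, §2.2.  Everything below is proved from Mathlib and the tree; axioms are the standard three.
-/

set_option linter.dupNamespace false -- D-0017: single-problem summit ⇒ `QuantumAdvantage.QuantumAdvantage` by design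

noncomputable section

namespace Summit.QuantumAdvantage.QuantumAdvantage.Theorems.CubicForrelation.NearExactIsExact

open Finset
open Literature.Computability.QuantumComplexity
open Literature.Computability.QuantumComplexity.BuzetChailloux (bxor zeroVec bxor_bxor_cancel_left bxor_zeroVec zeroVec_bxor
  twist_bxor_right)
open Literature.Computability.QuantumComplexity.DerivativeWalsh (W twist_bxor_left sum_char_subspace)

variable {n : ℕ}

/-! ### Peeling parametrised flats -/

/-- Splitting a sum over `𝔽₂^{k+1}` by the first parameter. [folklore] -/
theorem tep_sum_split {M : Type*} [AddCommMonoid M] {k : ℕ} (F : (Fin (k + 1) → Bool) → M) :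
    ∑ ε, F ε = ∑ ε : Fin k → Bool, F (Fin.cons false ε) + ∑ ε : Fin k → Bool, F (Fin.cons true ε) := by
  rw [← Fintype.sum_equiv (Fin.consEquiv fun _ => Bool) (fun p => F (Fin.consEquiv (fun _ => Bool) p)) F (fun _ => rfl),
    Fintype.sum_prod_type, Fintype.sum_bool]
  simp [Fin.consEquiv, add_comm]

/-- A parametrised flat with no directions is its base point. [folklore] -/
theorem tep_flatPt_nil (b : Fin n → Bool) (a : Fin 0 → Fin n → Bool) (ε : Fin 0 → Bool) :
    (fun j => b j ^^ decide (Odd #(univ.filter fun i => ε i && a i j))) = b := by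
  funext j
  rw [show (univ.filter fun i : Fin 0 => ε i && a i j) = ∅ from filter_eq_empty_iff.2 fun i => i.elim0]
  simp

/-- The first three binary digits: `a = 4⌊⌊a/2⌋/2⌋ + 2[⌊a/2⌋ odd] + [a odd]`. [folklore] -/
theorem tep_mod_four (a : ℤ) : a = 4 * (a / 2 / 2) + 2 * (if Odd (a / 2) then 1 else 0) + (if Odd a then 1 else 0) := by
  have h0 := td_two_mul_div_add a
  have h1 := td_two_mul_div_add (a / 2)
  omega

/-! ### Transversal directions and parity on translates -/

/-- Two transversal directions: if `|V₀| ≤ 127` there are `d₁, d₂` with `d₁, d₂, d₁ ⊕ d₂ ∉ V₀`. [folklore] -/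
theorem tep_dirs (V₀ : Finset (Fin (4 + 4) → Bool)) (hcard : #V₀ ≤ 127) :
    ∃ d₁ d₂ : Fin (4 + 4) → Bool, d₁ ∉ V₀ ∧ d₂ ∉ V₀ ∧ bxor d₁ d₂ ∉ V₀ := by
  classical
  have huniv : #(univ : Finset (Fin (4 + 4) → Bool)) = 256 := by simp
  obtain ⟨d₁, -, hd₁⟩ : ∃ d₁ ∈ (univ : Finset (Fin (4 + 4) → Bool)), d₁ ∉ V₀ :=
    exists_mem_notMem_of_card_lt_card (by rw [huniv]; omega)
  have hS : #(V₀ ∪ V₀.image (bxor d₁)) < #(univ : Finset (Fin (4 + 4) → Bool)) := by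
    rw [huniv]
    calc #(V₀ ∪ V₀.image (bxor d₁)) ≤ #V₀ + #(V₀.image (bxor d₁)) := card_union_le _ _
      _ ≤ 127 + 127 := Nat.add_le_add hcard (card_image_le.trans hcard)
      _ < 256 := by norm_num
  obtain ⟨d₂, -, hd₂⟩ := exists_mem_notMem_of_card_lt_card hS
  rw [mem_union, not_or] at hd₂
  refine ⟨d₁, d₂, hd₁, hd₂.1, fun h => hd₂.2 (mem_image.2 ⟨bxor d₁ d₂, h, bxor_bxor_cancel_left d₁ d₂⟩)⟩

/-- **Parity on translates of the flat.** If the even set of `v` is the coset `x₀ ⊕ V₀` (`V₀` `⊕`-closed), then for `x` in it and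
`c ∈ V₀`: `v(x ⊕ c ⊕ t)` is even iff `t ∈ V₀`. [folklore] -/
theorem tep_parity_translate (v : (Fin (4 + 4) → Bool) → ℤ) (V₀ : Finset (Fin (4 + 4) → Bool)) (x₀ : Fin (4 + 4) → Bool)
    (hadd : ∀ a ∈ V₀, ∀ b ∈ V₀, bxor a b ∈ V₀) (hZ : (univ.filter fun x => ¬ Odd (v x)) = V₀.image (bxor x₀))
    {x c : Fin (4 + 4) → Bool} (hx : ¬ Odd (v x)) (hc : c ∈ V₀) (t : Fin (4 + 4) → Bool) :
    ¬ Odd (v (bxor (bxor x c) t)) ↔ t ∈ V₀ := by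
  -- membership in the even set, read through `hZ`
  have hev : ∀ y, ¬ Odd (v y) ↔ bxor x₀ y ∈ V₀ := by
    intro y
    have : y ∈ (univ.filter fun x => ¬ Odd (v x)) ↔ y ∈ V₀.image (bxor x₀) := by rw [hZ]
    simp only [mem_filter, mem_univ, true_and, mem_image] at this
    rw [this]
    constructor
    · rintro ⟨a, ha, rfl⟩; rwa [bxor_bxor_cancel_left]
    · intro h; exact ⟨bxor x₀ y, h, bxor_bxor_cancel_left x₀ y⟩
  rw [hev]
  have hm : bxor x₀ x ∈ V₀ := (hev x).1 hx
  have hmc : bxor (bxor x₀ x) c ∈ V₀ := hadd _ hm _ hc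
  have e : bxor x₀ (bxor (bxor x c) t) = bxor (bxor (bxor x₀ x) c) t := by
    funext j; show (x₀ j ^^ ((x j ^^ c j) ^^ t j)) = (((x₀ j ^^ x j) ^^ c j) ^^ t j); simp only [Bool.xor_assoc]
  rw [e]
  constructor
  · intro h
    have := hadd _ hmc _ h
    rwa [bxor_bxor_cancel_left] at this
  · intro ht; exact hadd _ hmc _ ht

/-! ### Characters on the coset and the four frequencies -/

/-- **Twisted coset sums of a `±`-character.** Let `V₀ ∋ 0` be `⊕`-closed and `A` a real function with `A(x₀ ⊕ c) = ±1` for `c ∈ V₀`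
that is multiplicative along `V₀` (`A(x₀ ⊕ c ⊕ c')·A(x₀) = A(x₀ ⊕ c)·A(x₀ ⊕ c')`).  Then for every `y` the twisted coset sum
`Σ_{c ∈ V₀} A(x₀ ⊕ c)(−1)^{(x₀⊕c)·y}` is `0` or `±|V₀|`. [cite: ODonnell2014, §3.3] -/
theorem tep_char_coset (V₀ : Finset (Fin (4 + 4) → Bool)) (h0 : zeroVec ∈ V₀) (hadd : ∀ a ∈ V₀, ∀ b ∈ V₀, bxor a b ∈ V₀)
    (x₀ : Fin (4 + 4) → Bool) (A : (Fin (4 + 4) → Bool) → ℝ) (hA : ∀ c ∈ V₀, A (bxor x₀ c) = 1 ∨ A (bxor x₀ c) = -1)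
    (hmul : ∀ c ∈ V₀, ∀ c' ∈ V₀, A (bxor x₀ (bxor c c')) * A x₀ = A (bxor x₀ c) * A (bxor x₀ c')) (y : Fin (4 + 4) → Bool) :
    ∃ r : ℝ, (r = 0 ∨ r = 1 ∨ r = -1) ∧ ∑ c ∈ V₀, A (bxor x₀ c) * twist (bxor x₀ c) y = r * #V₀ := by
  have hA0 : A x₀ = 1 ∨ A x₀ = -1 := by simpa only [bxor_zeroVec] using hA zeroVec h0
  have hA0sq : A x₀ * A x₀ = 1 := by rcases hA0 with h | h <;> rw [h] <;> norm_num
  -- the character `χ(c) = A(x₀ ⊕ c) A(x₀) (−1)^{c·y}`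
  have hχ := sum_char_subspace hadd (fun c => A (bxor x₀ c) * A x₀ * twist c y)
    (fun c hc => by
      rcases hA c hc with h | h <;> rcases hA0 with h' | h' <;> rcases Simon.twist_eq_one_or c y with h'' | h'' <;>
        simp only [h, h', h''] <;> norm_num)
    (fun c hc c' hc' => by
      show A (bxor x₀ (bxor c c')) * A x₀ * twist (bxor c c') y =
        A (bxor x₀ c) * A x₀ * twist c y * (A (bxor x₀ c') * A x₀ * twist c' y)
      rw [twist_bxor_left, hmul c hc c' hc']
      linear_combination (A (bxor x₀ c) * A (bxor x₀ c') * twist c y * twist c' y) * hA0sq.symm)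
  have hre : ∑ c ∈ V₀, A (bxor x₀ c) * twist (bxor x₀ c) y =
      A x₀ * twist x₀ y * ∑ c ∈ V₀, A (bxor x₀ c) * A x₀ * twist c y := by
    rw [mul_sum]
    refine sum_congr rfl fun c _ => ?_
    rw [twist_bxor_left]
    linear_combination (A (bxor x₀ c) * twist x₀ y * twist c y) * hA0sq.symm
  rw [hre]
  rcases hχ with h | h <;> rw [h]
  · refine ⟨A x₀ * twist x₀ y, ?_, by ring⟩
    rcases hA0 with h' | h' <;> rcases Simon.twist_eq_one_or x₀ y with h'' | h'' <;> simp [h', h'']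
  · exact ⟨0, Or.inl rfl, by ring⟩

/-- **Four frequencies.** If a transform `T` takes values in `{0, ±64}` and has energy `Σ T² = 2⁸·64`, then its pairing with any function
bounded by `1` is at most `256` in absolute value (`Σ|T| = Σ T²/64 = 256`). [folklore] -/
theorem tep_abs_sum_le (T σ : (Fin (4 + 4) → Bool) → ℝ) (hT : ∀ y, T y = 0 ∨ T y = 64 ∨ T y = -64)
    (hP : ∑ y, T y ^ 2 = 2 ^ 8 * 64) (hσ : ∀ y, |σ y| ≤ 1) : |∑ y, σ y * T y| ≤ 256 := by
  have habs : ∀ y, |T y| = T y ^ 2 / 64 := by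
    intro y; rcases hT y with h | h | h <;> rw [h] <;> norm_num
  calc |∑ y, σ y * T y| ≤ ∑ y, |σ y * T y| := abs_sum_le_sum_abs _ _
    _ ≤ ∑ y, |T y| := sum_le_sum fun y _ => by
        rw [abs_mul]
        calc |σ y| * |T y| ≤ 1 * |T y| := mul_le_mul_of_nonneg_right (hσ y) (abs_nonneg _)
          _ = |T y| := one_mul _
    _ = ∑ y, T y ^ 2 / 64 := sum_congr rfl fun y _ => habs y
    _ = 256 := by rw [← sum_div, hP]; norm_num

end Summit.QuantumAdvantage.QuantumAdvantage.Theorems.CubicForrelation.NearExactIsExact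

end
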